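import Literature.NumberTheory.Automorphic.AddCharConductorExponent
import Literature.NumberTheory.Automorphic.TateLocalFunctionalEquation
import Literature.NumberTheory.Automorphic.TateLocalZetaShells
import Literature.NumberTheory.Automorphic.AdicCompletionCompact
import Literature.NumberTheory.Automorphic.AdicCompletionLocalField
import Literature.NumberTheory.GaloisRepresentations.HeckeCharacter
import HarnessLib

/-!
# Deeply ramified twists: a bound on the order of ramification from the unit filtration

Topic `Literature/NumberTheory/Automorphic`; proof file (theorems only: no definition, no named
fact, no instance).  Local part (`F` a non-archimedean local field): for `N ≥ 1` the unit
filtration `U^N = 1 + 𝔭^N ⊆ Fˣ` (`unitFiltration F N`, Bushnell–Henniart 2006, §1.1) is a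
subgroup (`one_mem_unitFiltration` of `TateLocalFunctionalEquation`, `mul_mem_unitFiltration`,
`inv_mem_unitFiltration`), open (a neighbourhood of `1`, `unitFiltration_mem_nhds_one`).  Global part (`K` a number field, `v` a
finite place): its preimage in the compact group `𝒪_vˣ` has FINITE INDEX
(`exists_finiteIndex_forall_map_mem_unitFiltration`), whence the dictionary entry used by clause
(N) ("sufficiently ramified twists have trivial local factor") of the standard `L`-function theory
of cuspidal `GL(2)` (`JacquetLanglands1970_standardLTheoryGL2`; Jacquet–Langlands 1970,
Prop. 3.8): **there is `M = M(v, N) > 0` such that every Hecke character `ω` whose local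
component `ω_v` is trivial on `U^N` has `ω^M` unramified at `v`**
(`HeckeCharacter.exists_pow_isUnramifiedAt_of_forall_unitFiltration`; `M` = the index, by
`Subgroup.pow_index_mem`).  Contrapositively: if `ω, ω², …, ω^M` are all ramified at `v` then `ω_v`
is non-trivial on `U^N` — the hypothesis of the deep-twist vanishing theorem
`exists_unitFiltration_forall_hasRSLFactor_twist_eq_one` (`GL2LFactorTwistVanishing`)
(`HeckeCharacter.exists_unitFiltration_ne_one_of_forall_pow_not_isUnramifiedAt`).

## References

* H. Jacquet, R. P. Langlands, *Automorphic Forms on GL(2)*, LNM 114 (1970), Prop. 3.8.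
  [JacquetLanglands1970]
* C. J. Bushnell, G. Henniart, *The local Langlands conjecture for GL(2)* (2006), §1.1, §1.8.
  [BushnellHenniart2006]
* J. Neukirch, *Algebraic Number Theory*, Ch. VII §6. [NeukirchANT1999]
-/

noncomputable section

open scoped NNReal Topology
open NumberField IsDedekindDomain

namespace Literature.NumberTheory.Automorphic

open Literature.NumberTheory.GaloisRepresentations
open Literature.NumberTheory.GaloisRepresentations.IsNonarchimedeanLocalField

/-! ### The unit filtration is a subgroup -/

section Local

variable {F : Type*} [Field F] [ValuativeRel F] [TopologicalSpace F] [IsNonarchimedeanLocalField F]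

/-- `U^N` is closed under multiplication: `xy - 1 = x (y - 1) + (x - 1)` and `|x| = 1`.
[cite: BushnellHenniart2006, §1.1] -/
theorem mul_mem_unitFiltration {N : ℕ} {x y : Fˣ} (hx : x ∈ unitFiltration F N)
    (hy : y ∈ unitFiltration F N) : x * y ∈ unitFiltration F N := by
  refine ⟨by rw [Units.val_mul, map_mul, hx.1, hy.1, one_mul], ?_⟩
  have h : ((x * y : Fˣ) : F) - 1 = (x : F) * ((y : F) - 1) + ((x : F) - 1) := by
    push_cast; ring
  rw [h]
  refine (normAbs_add_le_max _ _).trans (max_le ?_ hx.2)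
  rw [map_mul, hx.1, one_mul]
  exact hy.2

/-- `U^N` is closed under inversion: `x⁻¹ - 1 = -(x⁻¹ (x - 1))`. [cite: BushnellHenniart2006, §1.1] -/
theorem inv_mem_unitFiltration {N : ℕ} {x : Fˣ} (hx : x ∈ unitFiltration F N) :
    x⁻¹ ∈ unitFiltration F N := by
  have hinv : normAbs F ((x⁻¹ : Fˣ) : F) = 1 := by
    rw [Units.val_inv_eq_inv_val, map_inv₀, hx.1, inv_one]
  refine ⟨hinv, ?_⟩
  have h : ((x⁻¹ : Fˣ) : F) - 1 = -(((x⁻¹ : Fˣ) : F) * ((x : F) - 1)) := by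
    rw [mul_sub, mul_one, ← Units.val_mul, inv_mul_cancel, Units.val_one, neg_sub]
  rw [h, normAbs_neg, map_mul, hinv, one_mul]
  exact hx.2

end Local

/-! ### The preimage of `U^N` in `𝒪_vˣ` has finite index -/

section Global

variable {K : Type} [Field K] [NumberField K]

/-- **The preimage of `U^N_{K_v}` in the compact group `𝒪_vˣ` is a subgroup of finite index.**
[cite: BushnellHenniart2006, §1.1] [cite: NeukirchANT1999, Ch. II §5] -/
theorem exists_finiteIndex_forall_map_mem_unitFiltration (v : HeightOneSpectrum (𝓞 K)) (N : ℕ) :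
    ∃ H : Subgroup (v.adicCompletionIntegers K)ˣ, H.FiniteIndex ∧
      ∀ u ∈ H, Units.map ((v.adicCompletionIntegers K).subtype : _ →* _) u ∈
        unitFiltration (v.adicCompletion K) N := by
  let U : Subgroup (v.adicCompletion K)ˣ :=
    { carrier := unitFiltration (v.adicCompletion K) N
      mul_mem' := fun hx hy => mul_mem_unitFiltration hx hy
      one_mem' := one_mem_unitFiltration N
      inv_mem' := fun hx => inv_mem_unitFiltration hx }
  let f : (v.adicCompletionIntegers K)ˣ →* (v.adicCompletion K)ˣ :=
    Units.map ((v.adicCompletionIntegers K).subtype : _ →* _)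
  have hf : Continuous f := Continuous.units_map _ continuous_subtype_val
  let H : Subgroup (v.adicCompletionIntegers K)ˣ := U.comap f
  have hUopen : IsOpen (U : Set (v.adicCompletion K)ˣ) :=
    Subgroup.isOpen_of_mem_nhds U (unitFiltration_mem_nhds_one N)
  have hHopen : IsOpen (H : Set (v.adicCompletionIntegers K)ˣ) := hUopen.preimage hf
  haveI : CompactSpace (v.adicCompletionIntegers K) := compactSpace_adicCompletionIntegers' K v
  haveI : Finite ((v.adicCompletionIntegers K)ˣ ⧸ H) := Subgroup.quotient_finite_of_isOpen H hHopen
  exact ⟨H, Subgroup.finiteIndex_of_finite_quotient, fun u hu => hu⟩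

end Global

end Literature.NumberTheory.Automorphic

namespace Literature.NumberTheory.GaloisRepresentations.HeckeCharacter

open Literature.NumberTheory.Automorphic

variable {K : Type} [Field K] [NumberField K]

/-- Local components of powers are powers of local components. [folklore] -/
theorem localComponent_pow_apply (ω : HeckeCharacter K) (n : ℕ) (v : HeightOneSpectrum (𝓞 K))
    (u : (v.adicCompletion K)ˣ) :
    (ω ^ n).localComponent v u = ω.localComponent v u ^ n := by
  rw [localComponent_apply, localComponent_apply, pow_apply]

/-- **Deep ramification is bounded by the unit filtration** (the dictionary entry behind
Jacquet–Langlands 1970, Prop. 3.8 in the global statement): for every finite place `v` and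
`N`, there is `M = M(v, N) > 0` such that every Hecke character `ω` whose local component is
trivial on `U^N_{K_v}` has `ω^M` UNRAMIFIED at `v` (`M` = the index of the preimage of `U^N` in
`𝒪_vˣ`; `u^M` lies in it for every `u ∈ 𝒪_vˣ`). [cite: JacquetLanglands1970, Prop. 3.8]
[cite: NeukirchANT1999, Ch. VII §6] -/
theorem exists_pow_isUnramifiedAt_of_forall_unitFiltration (v : HeightOneSpectrum (𝓞 K)) (N : ℕ) :
    ∃ M : ℕ, 0 < M ∧ ∀ ω : HeckeCharacter K,
      (∀ x ∈ unitFiltration (v.adicCompletion K) N, ω.localComponent v x = 1) →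
        (ω ^ M).IsUnramifiedAt v := by
  obtain ⟨H, hH, hHU⟩ := exists_finiteIndex_forall_map_mem_unitFiltration v N
  haveI := hH
  refine ⟨H.index, Nat.pos_of_ne_zero Subgroup.FiniteIndex.index_ne_zero, fun ω hω u => ?_⟩
  rw [localComponent_pow_apply, ← map_pow, ← map_pow]
  exact hω _ (hHU _ (Subgroup.pow_index_mem H u))

/-- **Contrapositive form** (the hypothesis of the deep-twist vanishing theorem
`exists_unitFiltration_forall_hasRSLFactor_twist_eq_one`): with `M = M(v, N)` as above, if
`ω, ω², …, ω^M` are all ramified at `v` then `ω_v` is non-trivial on `U^N_{K_v}`.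
[cite: JacquetLanglands1970, Prop. 3.8] -/
theorem exists_unitFiltration_ne_one_of_forall_pow_not_isUnramifiedAt
    (v : HeightOneSpectrum (𝓞 K)) (N : ℕ) :
    ∃ M : ℕ, 0 < M ∧ ∀ ω : HeckeCharacter K,
      (∀ k : ℕ, 0 < k → k ≤ M → ¬ (ω ^ k).IsUnramifiedAt v) →
        ∃ x ∈ unitFiltration (v.adicCompletion K) N, ω.localComponent v x ≠ 1 := by
  obtain ⟨M, hM, h⟩ := exists_pow_isUnramifiedAt_of_forall_unitFiltration (K := K) v N
  refine ⟨M, hM, fun ω hω => ?_⟩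
  by_contra hne
  push Not at hne
  exact hω M hM le_rfl (h ω hne)

end Literature.NumberTheory.GaloisRepresentations.HeckeCharacter

end
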